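import Literature.NumberTheory.Automorphic.Liu2021.AppendixC.RestOneLevelInvariants
import Literature.NumberTheory.DiophantineGeometry.AVIsogenyTateHoldsProofs
import Mathlib.RingTheory.Flat.Localization
import HarnessLib

/-!
# [Liu2021, Thm. 4.18 (1)] reduced — the inputs (I), (D) from statements about HOMOMORPHISMS of abelian varieties

[Liu2021] = Yifeng Liu, *Fourier–Jacobi cycles and arithmetic relative trace formula*, Camb. J. Math. **9** (2021) 1–147 =
arXiv:2102.11518 (`FJcycle.tex` line numbers as in `AppendixC/Glue.lean`).  Sequel of `AppendixC/RestOneLevelInvariants.lean`, which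
reduces Thm. 4.18 (1) AS TYPED («`res K D_μ : ℚ ⊗ Hom_E(A_K, A_μ) → Ω(μ)` injective with image `Ω(μ)^K`», l. 2239) for the one-object
Hecke datum and all its transports to two predicates on the Albanese tower stated on the RATIONAL Hom groups `ℚ ⊗_ℤ Hom_E(A_K, B)`:
(I) `Sec42Data.PullInjective` and (D) `Sec42Data.HeckeTranslates.LevelDescent`.  PROOF FILE (theorems + ONE hypothesis predicate,
no named fact, no instance, no `sorry`) deriving them from statements about HOMOMORPHISMS, the shape in which algebraic geometry
supplies them:

* §1 `RestOne.exists_eq_inv_natCast_tmul` — every element of `ℚ ⊗_ℤ M` is `n⁻¹ ⊗ m` (common denominators);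
  `RestOne.tmul_eq_zero_iff_of_free` — for `M` free over `ℤ`, `q ⊗ m = 0` (`q ≠ 0`) iff `m = 0` (`ℤ → ℚ` injective, `M` flat).
* §2 `RestOne.pre_injective_of_epi` — for an EPIMORPHISM `u : X' → X` of abelian varieties, `φ ↦ u ≫ φ` is injective on
  `ℚ ⊗_ℤ Hom(X, B)` (`ℚ` flat over `ℤ`, Mathlib `IsLocalization.flat`).
* §3 `Sec42Data.pullInjective_of_epi` — (I) holds as soon as every `Alb_{u^{K'}_K}` is an epimorphism (§4.2 l. 2064: `u^{K'}_K` is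
  «generically finite dominant», so `Alb_u` is onto); `Sec42Data.HeckeTranslates.IsogenyDescent` — (D) at the level of homomorphisms:
  a `K`-invariant `φ : A_N → B` (`N ⊆ K` normalised by `K`) has `Alb_{u^N_K} ≫ ψ = m·φ` for some `ψ : A_K → B`, `m ≠ 0` («descent up
  to isogeny»: `Alb(X_N)_{K/N} → Alb(X_K)` is an isogeny); `levelDescent_of_isogenyDescent : IsogenyDescent → LevelDescent`, using
  that `Hom_E(A_N, B)` is a FREE `ℤ`-module ([MumfordAV1970] §19 Thm. 3 — the tree's PROVED `AbelianVariety.module_free_hom_holds`);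
  `levelInvariants_transport_of_epi_of_isogenyDescent` — Thm. 4.18 (1) AS TYPED for every transport of the one-object Hecke datum
  from «`Alb_u` epi» + `IsogenyDescent`.

HC_CM is NOT proved; nothing here discharges a binder by itself.  References: [Liu2021] Thm. 4.18 (1) l. 2239, §4.2 l. 2062–2074,
Lem. 2.4 (1); [MumfordAV1970] §19 Thm. 3.
-/

set_option autoImplicit false

noncomputable section

open CategoryTheory NumberField
open scoped TensorProduct

namespace Literature.NumberTheory.Automorphic.Liu2021.AppendixC

namespace RestOne

/-! ## §1. `ℚ ⊗_ℤ M`: common denominators; no new torsion for free `M` -/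
section QTensor

variable {M : Type*} [AddCommGroup M]

/-- Every element of `ℚ ⊗_ℤ M` is `n⁻¹ ⊗ m` for some `n ≥ 1`, `m ∈ M` (common denominators; `ℚ ⊗_ℤ M = S⁻¹M`, `S = ℤ ∖ 0`).
[cite: AtiyahMacdonald1969, Prop. 3.5 (S⁻¹A ⊗_A M ≅ S⁻¹M)] -/
theorem exists_eq_inv_natCast_tmul (t : ℚ ⊗[ℤ] M) : ∃ (n : ℕ) (m : M), n ≠ 0 ∧ t = ((n : ℚ)⁻¹) ⊗ₜ[ℤ] m := by
  induction t using TensorProduct.induction_on with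
  | zero => exact ⟨1, 0, one_ne_zero, by simp⟩
  | tmul q m =>
    refine ⟨q.den, q.num • m, q.den_ne_zero, ?_⟩
    rw [← TensorProduct.smul_tmul, zsmul_eq_mul, ← div_eq_mul_inv, Rat.num_div_den]
  | add x y hx hy =>
    obtain ⟨n, m, hn, rfl⟩ := hx
    obtain ⟨n', m', hn', rfl⟩ := hy
    refine ⟨n * n', (n' : ℤ) • m + (n : ℤ) • m', mul_ne_zero hn hn', ?_⟩
    have hnq : (n : ℚ) ≠ 0 := Nat.cast_ne_zero.2 hn
    have hnq' : (n' : ℚ) ≠ 0 := Nat.cast_ne_zero.2 hn'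
    rw [TensorProduct.tmul_add, ← TensorProduct.smul_tmul, ← TensorProduct.smul_tmul, zsmul_eq_mul, zsmul_eq_mul,
      Int.cast_natCast, Int.cast_natCast, Nat.cast_mul]
    congr 2
    · field_simp
    · field_simp

/-- For `M` free over `ℤ` and `q ≠ 0`: `q ⊗ m = 0` in `ℚ ⊗_ℤ M` iff `m = 0` (`M → ℚ ⊗_ℤ M` is injective: `ℤ → ℚ` is injective and
`M` is flat; i.e. a torsion-free module embeds in its localisation). [cite: AtiyahMacdonald1969, Prop. 3.5 and Prop. 3.8] -/
theorem tmul_eq_zero_iff_of_free [Module.Free ℤ M] {q : ℚ} (hq : q ≠ 0) (m : M) : q ⊗ₜ[ℤ] m = 0 ↔ m = 0 := by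
  constructor
  · intro h
    have h1 : (1 : ℚ) ⊗ₜ[ℤ] m = 0 := by
      have := congrArg (fun x : ℚ ⊗[ℤ] M => q⁻¹ • x) h
      simpa only [TensorProduct.smul_tmul', smul_eq_mul, inv_mul_cancel₀ hq, smul_zero] using this
    have hinj : Function.Injective ((Algebra.linearMap ℤ ℚ).rTensor M) :=
      Module.Flat.rTensor_preserves_injective_linearMap _ fun a b hab => by
        simpa only [Algebra.linearMap_apply, algebraMap_int_eq, Int.coe_castRingHom, Int.cast_inj] using hab
    have h2 : (Algebra.linearMap ℤ ℚ).rTensor M ((1 : ℤ) ⊗ₜ[ℤ] m) = (1 : ℚ) ⊗ₜ[ℤ] m := by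
      rw [LinearMap.rTensor_tmul, Algebra.linearMap_apply, map_one]
    have h3 : (1 : ℤ) ⊗ₜ[ℤ] m = 0 := hinj (by rw [h2, h1, map_zero])
    have h4 := congrArg (TensorProduct.lid ℤ M) h3
    simpa using h4
  · rintro rfl
    exact TensorProduct.tmul_zero _ _

end QTensor

/-! ## §2. Pull-back along an EPIMORPHISM of abelian varieties is injective on `ℚ ⊗ Hom` -/
section PreComp

variable {k : Type} [Field k] (B : Literature.AlgebraicGeometry.Motives.AbelianVariety k)
  {X X' : Literature.AlgebraicGeometry.Motives.AbelianVariety k}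

/-- If `u : X' → X` is an epimorphism of abelian varieties then `φ ↦ u ≫ φ` is injective on `Hom⁰ = ℚ ⊗_ℤ Hom(X, B)` (`ℚ` is flat
over `ℤ`: exactness of localisation). [cite: AtiyahMacdonald1969, Prop. 3.3 (S⁻¹ is exact)] [cite: MumfordAV1970, §19 (Hom⁰(X,Y) = Hom(X,Y) ⊗ ℚ)] -/
theorem pre_injective_of_epi (u : X' ⟶ X) [Epi u] : Function.Injective (pre B u) := by
  haveI : Module.Flat ℤ ℚ := IsLocalization.flat ℚ (nonZeroDivisors ℤ)
  have hg : Function.Injective (Preadditive.leftComp B u).toIntLinearMap := by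
    intro φ ψ h
    exact (cancel_epi u).1 h
  unfold pre
  rw [LinearMap.baseChange_eq_ltensor]
  exact Module.Flat.lTensor_preserves_injective_linearMap _ hg

end PreComp

end RestOne

/-! ## §3. (I) from epimorphic `Alb_u`; (D) from descent up to isogeny at the level of homomorphisms -/
section Bridges

variable {F E : Type} [Field F] [NumberField F] [IsTotallyReal F] [Field E] [NumberField E] [Algebra F E]
  [IsTotallyComplex E] [Algebra.IsQuadraticExtension F E]
variable {P5 : PropC5Data F E} {isotropicAt : ℕ → Prop}

/-- **(I) from epimorphisms**: if every Albanese transition homomorphism `Alb_{u^{K'}_K} : A_{K'} → A_K` is an epimorphism of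
abelian varieties (e.g. surjective — `u^{K'}_K` is «generically finite dominant», §4.2 l. 2064), then `C.PullInjective`.
[cite: Liu2021, §4.2 FJcycle.tex l. 2064–2072] -/
theorem Sec42Data.pullInjective_of_epi (C : Sec42Data P5 isotropicAt)
    (h : ∀ ⦃K K' : C5.SmallLevel C.S.K₀⦄ (f : K' ⟶ K), Epi (C.Atr f)) : C.PullInjective :=
  fun _ _ f B => by
    haveI := h f
    exact RestOne.pre_injective_of_epi B (C.Atr f)

/-- **INPUT (D) at the level of homomorphisms — descent up to isogeny**: for sufficiently small levels `N ⊆ K` with `N`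
normalised by `K`, every homomorphism `φ : A_N → B` with `Alb(T_k) ≫ φ = φ` for all `k ∈ K` satisfies `Alb_{u^N_K} ≫ ψ = m·φ`
for some `ψ : A_K → B` and some integer `m ≠ 0` (for Liu's tower: `Alb(X_N)_{K/N} → Alb(X_K)` is an isogeny).  A PREDICATE on
`(C, T)` (not asserted). [cite: Liu2021, Thm. 4.18 (1) FJcycle.tex l. 2239 and Lem. 2.4 (1)] -/
def Sec42Data.HeckeTranslates.IsogenyDescent {C : Sec42Data P5 isotropicAt} (T : C.HeckeTranslates) : Prop :=
  ∀ ⦃N K : C5.SmallLevel C.S.K₀⦄ (h : N ≤ K) (hn : ∀ k ∈ K.1.1, C5.HeckeLE k N N)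
    (B : Literature.AlgebraicGeometry.Motives.AbelianVariety E) (φ : C.A N ⟶ B),
    (∀ (k : C.G) (hk : k ∈ K.1.1), T.albTr k N N (hn k hk) ≫ φ = φ) →
      ∃ (m : ℤ) (ψ : C.A K ⟶ B), m ≠ 0 ∧ C.Atr (homOfLE h) ≫ ψ = m • φ

/-- **(D) from descent up to isogeny**: `T.IsogenyDescent → T.LevelDescent` (common denominators in `ℚ ⊗ Hom`; `Hom(A_N, B)` is a
free `ℤ`-module — Mumford §19 Thm. 3, the tree's `AbelianVariety.module_free_hom_holds` — so Hecke invariance of `n⁻¹ ⊗ φ` is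
Hecke invariance of `φ`). [cite: Liu2021, Thm. 4.18 (1) FJcycle.tex l. 2239] -/
theorem Sec42Data.HeckeTranslates.levelDescent_of_isogenyDescent {C : Sec42Data P5 isotropicAt} (T : C.HeckeTranslates)
    (h : T.IsogenyDescent) : T.LevelDescent := by
  intro N K hle hn B t hinv
  haveI : Module.Free ℤ (C.A N ⟶ B) := Literature.AlgebraicGeometry.Motives.AbelianVariety.module_free_hom_holds _ _
  obtain ⟨n, φ, hn0, rfl⟩ := RestOne.exists_eq_inv_natCast_tmul t
  have hnq : ((n : ℚ)⁻¹) ≠ 0 := inv_ne_zero (Nat.cast_ne_zero.2 hn0)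
  have hφ : ∀ (k : C.G) (hk : k ∈ K.1.1), T.albTr k N N (hn k hk) ≫ φ = φ := by
    intro k hk
    have h1 := hinv k hk
    rw [RestOne.pre_tmul, ← sub_eq_zero, ← TensorProduct.tmul_sub, RestOne.tmul_eq_zero_iff_of_free hnq] at h1
    exact sub_eq_zero.1 h1
  obtain ⟨m, ψ, hm0, hψ⟩ := h hle hn B φ hφ
  refine ⟨((m : ℚ) * n)⁻¹ ⊗ₜ ψ, ?_⟩
  rw [RestOne.pre_tmul, hψ, ← TensorProduct.smul_tmul, zsmul_eq_mul]
  congr 1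
  have hmq : (m : ℚ) ≠ 0 := Int.cast_ne_zero.2 hm0
  field_simp

end Bridges

/-! ## §4. Thm. 4.18 (1) AS TYPED for the transported one-object Hecke datum, from «`Alb_u` epi» + `IsogenyDescent` -/
section Datum

variable {F E : Type} [Field F] [NumberField F] [IsTotallyReal F] [Field E] [NumberField E] [Algebra F E]
  [IsTotallyComplex E] [Algebra.IsQuadraticExtension F E] [IsCMField E]
variable {P5 : PropC5Data F E} {isotropicAt : ℕ → Prop} {C : Sec42Data P5 isotropicAt} (T : C.HeckeTranslates)
  (U : UniformOmega C)
variable {L : Type} [Field L] [NumberField L] [IsGalois ℚ L] (φ : E →ₐ[ℚ] L) (ι : L →+* ℂ)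
variable {μ : IdeleClassGroup E →ₜ* Circle} (hμ : IdeleClassGroup.IsConjugateSymplectic E μ)
  (hw : IdeleClassGroup.HasWeight E μ 1) (Car : Def45.Carriers E μ)
variable (G' : Type) [Group G'] [TopologicalSpace G'] [IsTopologicalGroup G'] (ψ : G' ≃ₜ* C.G)
  (Eps' : Type) (epsOf' : E → Eps') (Chi' : Type) (omega' : Eps' → Chi' → Type)
  [∀ ε χ, AddCommGroup (omega' ε χ)] [∀ ε χ, Module ℂ (omega' ε χ)]
  (rho' : ∀ ε χ, Representation ℂ G' (omega' ε χ))

/-- **[Liu2021, Thm. 4.18 (1)] AS TYPED for every transport of the one-object Hecke datum, from «every `Alb_{u^{K'}_K}` is an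
epimorphism» and `IsogenyDescent`** (composition of `levelInvariants_transport_toThm418Data_rest_restTailOne` with §3).
[cite: Liu2021, Thm. 4.18 (1) FJcycle.tex l. 2239; Rem. 4.17] -/
theorem levelInvariants_transport_of_epi_of_isogenyDescent
    (hE : ∀ ⦃K K' : C5.SmallLevel C.S.K₀⦄ (f : K' ⟶ K), Epi (C.Atr f)) (hD : T.IsogenyDescent) :
    ∀ Dμ : ((toThm418Data C (U.rest (restTailOne φ ι hμ hw Car (T.rhoΩOne φ ι hμ hw Car)))).transport
        G' ψ Eps' epsOf' Chi' omega' rho').Obj,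
      ∃ K₀ : Subgroup ((toThm418Data C (U.rest (restTailOne φ ι hμ hw Car (T.rhoΩOne φ ι hμ hw Car)))).transport
          G' ψ Eps' epsOf' Chi' omega' rho').G,
        IsOpenCompact K₀ ∧
        ∀ K : Subgroup ((toThm418Data C (U.rest (restTailOne φ ι hμ hw Car (T.rhoΩOne φ ι hμ hw Car)))).transport
            G' ψ Eps' epsOf' Chi' omega' rho').G,
          IsOpenCompact K → K ≤ K₀ →
            Function.Injective
                (((toThm418Data C (U.rest (restTailOne φ ι hμ hw Car (T.rhoΩOne φ ι hμ hw Car)))).transport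
                  G' ψ Eps' epsOf' Chi' omega' rho').res K Dμ) ∧
              Set.range (((toThm418Data C (U.rest (restTailOne φ ι hμ hw Car (T.rhoΩOne φ ι hμ hw Car)))).transport
                  G' ψ Eps' epsOf' Chi' omega' rho').res K Dμ) =
                ((toThm418Data C (U.rest (restTailOne φ ι hμ hw Car (T.rhoΩOne φ ι hμ hw Car)))).transport
                  G' ψ Eps' epsOf' Chi' omega' rho').invariants K :=
  levelInvariants_transport_toThm418Data_rest_restTailOne T U φ ι hμ hw Car G' ψ Eps' epsOf' Chi' omega' rho'
    (C.pullInjective_of_epi hE) (T.levelDescent_of_isogenyDescent hD)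

end Datum

end Literature.NumberTheory.Automorphic.Liu2021.AppendixC

end
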